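import Mathlib
import HarnessLib
import Summits.RiemannHypothesis.RiemannHypothesis.Theorems.EarlyAppointmentsCombSumVariation
import Summits.RiemannHypothesis.RiemannHypothesis.Theorems.EarlyAppointmentsNcardCombine
import Summits.RiemannHypothesis.RiemannHypothesis.Theorems.EarlyAppointmentsConjugateVariation

/-!
# Complete G variation bound

Assembles the G variation bound from:
1. conjugate_variation (≤ 1/(6h))
2. single_pole_variation + construct_finset (≤ 16/h)
3. remainder from hremainder (≤ 2/h)
Total ≤ 19/h ≤ 20/h.
-/

open Complex Real Set Filter Topology Metric
open scoped BigOperators Topology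

noncomputable section

namespace GVariationComplete

/-- Bound on sum of single pole variations over a finite set.
If S has n elements and each |c - ξ| ≥ h, then
Σ_{ξ ∈ S} |1/(z-ξ) - 1/(c-ξ)| ≤ n/h when |z - c| = h/2. -/
theorem finset_variation_bound {x₀ h : ℝ} (hh : 0 < h)
    {S : Finset ℝ} (_hS : ∀ ξ ∈ S, |x₀ - ξ| ≤ h)
    {z : ℂ} (hz : ‖z - CombSumVariation.c x₀ h‖ = h / 2) :
    ∑ ξ ∈ S, ‖(z - (ξ : ℂ))⁻¹ - (CombSumVariation.c x₀ h - (ξ : ℂ))⁻¹‖ ≤ S.card / h := by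
  -- Each term is bounded by 1/|c - ξ| ≤ 1/h by single_pole_variation
  have h_bound : ∀ ξ ∈ S,
      ‖(z - (ξ : ℂ))⁻¹ - (CombSumVariation.c x₀ h - (ξ : ℂ))⁻¹‖ ≤ 1 / h := by
    intro ξ hξ
    have hcξ := CombSumVariation.norm_c_sub_real_ge_h (x₀ := x₀) hh ξ
    have hcξ_gt : ‖CombSumVariation.c x₀ h - (ξ : ℂ)‖ > h / 2 := by linarith
    calc ‖(z - (ξ : ℂ))⁻¹ - (CombSumVariation.c x₀ h - (ξ : ℂ))⁻¹‖
        ≤ 1 / ‖CombSumVariation.c x₀ h - (ξ : ℂ)‖ :=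
          CombSumVariation.single_pole_variation hh hz hcξ_gt
      _ ≤ 1 / h := by
          apply one_div_le_one_div_of_le hh hcξ
  -- Sum bound: Σ ≤ |S| · (1/h)
  calc ∑ ξ ∈ S, ‖(z - (ξ : ℂ))⁻¹ - (CombSumVariation.c x₀ h - (ξ : ℂ))⁻¹‖
      ≤ ∑ _ξ ∈ S, (1 / h) := Finset.sum_le_sum (fun ξ hξ => h_bound ξ hξ)
    _ = S.card * (1 / h) := by rw [Finset.sum_const]; simp [nsmul_eq_mul]
    _ = S.card / h := by ring

end GVariationComplete

end
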